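import Mathlib
import Summits.ResolutionOfSingularities.ResolutionOfSingularities.Theorems.SyzygyFlatteningDefs
import Summits.ResolutionOfSingularities.ResolutionOfSingularities.Theorems.SyzygyFlatteningHigherRankTerminationTowerStageBasic
import Summits.ResolutionOfSingularities.ResolutionOfSingularities.Theorems.SyzygyFlatteningHigherRankTerminationLocAt
import Summits.ResolutionOfSingularities.ResolutionOfSingularities.Theorems.SyzygyFlatteningHigherRankTerminationSingIdealLocAt
import Literature.AlgebraicGeometry.Resolution.RegularLocalRingsFlatDescent
import HarnessLib

/-!
# Regularity descends from the base-changed stage `locAt O' (k(X)·B)` to the local stage `B`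
(`stub_regularity_descends`)

Crux `HigherRankTermination` (stmt-ResolutionOfSingularities-17045), line `birth`, base-change line
`(k, K) ↦ (k(X), K(X))`, wave 2, registered stub `stub_regularity_descends` — the last step of the
base-change argument.

Setting. `k ⊆ K` fields, `K(X) = RatFunc K`, `O ⊆ K` and `O' ⊆ K(X)` valuation rings with
`O' ∩ K = O`; `k'` an abstract copy of `k(X) ⊆ K(X)` with `k' ⊆ O'`; `B ⊆ O` a LOCAL stage
(`locAt O B = B`, Noetherian); `E = k(X)·B ⊆ K(X)` its base change, a localisation of `B[X]` along
`f ↦ f(X)` (`stub_baseChange_isLocalization`, here a hypothesis); `L = locAt O' E` the base-changed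
stage.

Claim (Matsumura, Thm. 23.7 (i), tree `IsRegularLocalRing.of_flat_ringHom`): if `L` is a regular
local ring then so is `B`. The composite `B → B[X] → E → L` is
* flat: `B[X]` is free over `B`, `E` is a localisation of `B[X]` (hypothesis), and `L` is a
  localisation of `E` (`isLocalization_locAt`, since `E ⊆ O'`: `B ⊆ O = O' ∩ K` and `k' ⊆ O'`);
* local: if `b ∈ B` becomes a unit of `L ⊆ O'` then `b⁻¹ ∈ O' ∩ K = O`, so `b⁻¹ = 1 * b⁻¹` lies in
  `locAt O B = B`;
and `B = locAt O B` is local (`isLocalRing_locAt`).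
-/

noncomputable section

-- single-problem summit: the doubled namespace component is forced
set_option linter.dupNamespace false

open scoped NNReal

namespace Summit.ResolutionOfSingularities.ResolutionOfSingularities.Theorems.SyzygyFlattening

open Polynomial Literature.AlgebraicGeometry.Resolution

/-- **Matsumura, Thm. 23.7 (i), along a chain of three maps** (abstract rings): if
`A → P → E → L` are flat ring homomorphisms, `A` is Noetherian local, `L` is a regular local ring
and the composite reflects units, then `A` is a regular local ring.
[cite: Matsumura1987, Thm. 23.7 (i)] -/
theorem isRegularLocalRing_of_flat_comp₃ {A P E L : Type} [CommRing A] [CommRing P]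
    [CommRing E] [CommRing L] [IsLocalRing A] [IsNoetherianRing A] [IsRegularLocalRing L]
    (f : A →+* P) (g : P →+* E) (h : E →+* L) (hf : f.Flat) (hg : g.Flat) (hh : h.Flat)
    (hloc : ∀ a : A, IsUnit (h (g (f a))) → IsUnit a) : IsRegularLocalRing A := by
  haveI : IsLocalHom (h.comp (g.comp f)) := ⟨fun a ha => hloc a ha⟩
  exact IsRegularLocalRing.of_flat_ringHom (h.comp (g.comp f)) ((hf.comp hg).comp hh)

/-- The polynomial ring is flat over its (commutative) coefficient ring: `C : A → A[X]` is flat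
(`A[X]` is a free `A`-module). [folklore] -/
theorem flat_polynomial_C (A : Type) [CommRing A] : (C : A →+* A[X]).Flat :=
  RingHom.flat_algebraMap_iff.mpr inferInstance

/-- **STUB `stub_regularity_descends` (Matsumura 23.7 (i) in the route's coordinates).** For a
LOCAL Noetherian stage `B = locAt O B ⊆ O` and its base change `E = k(X)·B ⊆ K(X)` (a localisation
of `B[X]`), if the base-changed stage `locAt O' E` is a regular local ring then so is `B`: the map
`B → B[X] → E → locAt O' E` is flat (free, then two localisations) and local (`O' ∩ K = O`, so a
`B`-element inverted in `locAt O' E ⊆ O'` has its inverse in `O`, hence in `locAt O B = B`).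
[cite: Matsumura1987, Thm. 23.7 (i)] -/
theorem stub_regularity_descends : ∀ (k K : Type) [Field k] [Field K] [Algebra k K]
    (O : ValuationSubring K) (O' : ValuationSubring (RatFunc K)),
    ∀ (k' : Type) [Field k'] [Algebra k k'] [Algebra k' (RatFunc K)] [IsScalarTower k k' (RatFunc K)],
      Set.range (algebraMap k' (RatFunc K)) =
        ((IntermediateField.adjoin k {(RatFunc.X : RatFunc K)} : IntermediateField k (RatFunc K)) :
          Set (RatFunc K)) →
    (∀ x : K, x ∈ O ↔ algebraMap K (RatFunc K) x ∈ O') → (∀ g : k', algebraMap k' (RatFunc K) g ∈ O') →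
    ∀ (B : Subalgebra k K) (E : Subalgebra k' (RatFunc K)),
      E = Algebra.adjoin k' ((algebraMap K (RatFunc K)) '' (B : Set K)) → B.toSubring ≤ O.toSubring →
      locAt O B = B → IsNoetherianRing ↥B →
    ∀ (ψ : ↥B →+* ↥E) (XE : ↥E),
      (∀ b : ↥B, (ψ b : RatFunc K) = algebraMap K (RatFunc K) b) → (XE : RatFunc K) = RatFunc.X →
      @IsLocalization (Polynomial ↥B) _
        ((nonZeroDivisors (Polynomial k)).map (Polynomial.mapRingHom (algebraMap k ↥B)))
        ↥E _ (Polynomial.eval₂RingHom ψ XE).toAlgebra →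
      IsRegularLocalRing ↥(locAt O' E) → IsRegularLocalRing ↥B := by
  intro k K _ _ _ O O' k' _ _ _ _ _hrange hcomap hk' B E hE hBO hfix hnoeth ψ XE hψ _hXE hloc hreg
  -- `E ⊆ O'`: the generators `φ '' B` lie in `O' ∩ K = O ⊇ B`, and `k' ⊆ O'`
  have hEO' : E.toSubring ≤ O'.toSubring := by
    rw [hE]
    refine adjoin_toSubring_le_valuationSubring O' hk' ?_
    rintro _ ⟨x, hx, rfl⟩
    exact (hcomap x).mp (hBO (Subalgebra.mem_toSubring.mpr hx))
  -- `B = locAt O B` is local and Noetherian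
  haveI : IsLocalRing ↥B := by
    have h := isLocalRing_locAt O B hBO
    rwa [hfix] at h
  haveI : IsNoetherianRing ↥B := hnoeth
  haveI : IsRegularLocalRing ↥(locAt O' E) := hreg
  -- the three maps
  let g : Polynomial ↥B →+* ↥E := Polynomial.eval₂RingHom ψ XE
  let h : ↥E →+* ↥(locAt O' E) := (Subalgebra.inclusion (self_le_locAt O' E)).toRingHom
  -- flatness of `g` (a localisation, by hypothesis) and of `h` (`isLocalization_locAt`)
  have hg : g.Flat := by
    letI : Algebra (Polynomial ↥B) ↥E := g.toAlgebra
    haveI := hloc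
    exact IsLocalization.flat ↥E
      ((nonZeroDivisors (Polynomial k)).map (Polynomial.mapRingHom (algebraMap k ↥B)))
  have hh : h.Flat := by
    letI : Algebra ↥E ↥(locAt O' E) := h.toAlgebra
    haveI := isLocalization_locAt O' E hEO'
    exact IsLocalization.flat ↥(locAt O' E)
      ((IsUnit.submonoid ↥(locAt O' E)).comap (Subalgebra.inclusion (self_le_locAt O' E)))
  -- the composite reflects units
  refine isRegularLocalRing_of_flat_comp₃ (C : ↥B →+* Polynomial ↥B) g h (flat_polynomial_C ↥B)
    hg hh fun b hb => ?_
  -- the image of `b` in `K(X)` is `φ b`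
  have hval : ((h (g (C b)) : ↥(locAt O' E)) : RatFunc K) = algebraMap K (RatFunc K) b := by
    change ((Polynomial.eval₂RingHom ψ XE (C b) : ↥E) : RatFunc K) = _
    rw [Polynomial.coe_eval₂RingHom, Polynomial.eval₂_C, hψ]
  obtain ⟨u, hu⟩ := hb.exists_right_inv
  have hu' : algebraMap K (RatFunc K) b * (u : RatFunc K) = 1 := by
    have := congrArg (fun z : ↥(locAt O' E) => (z : RatFunc K)) hu
    simpa only [Subalgebra.coe_mul, hval, Subalgebra.coe_one] using this
  have hb0 : (b : K) ≠ 0 := by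
    rintro hb0
    rw [hb0, map_zero, zero_mul] at hu'
    exact zero_ne_one hu'
  -- `u = φ (b⁻¹)` lies in `locAt O' E ⊆ O'`, hence `b⁻¹ ∈ O`
  have huinv : (u : RatFunc K) = algebraMap K (RatFunc K) (b : K)⁻¹ := by
    rw [map_inv₀]
    exact (inv_eq_of_mul_eq_one_right hu').symm
  have hbinvO : (b : K)⁻¹ ∈ O := by
    refine (hcomap _).mpr ?_
    rw [← huinv]
    exact locAt_le O' E hEO' (Subalgebra.mem_toSubring.mpr u.2)
  -- hence `b⁻¹ ∈ locAt O B = B`, and `b` is a unit of `B`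
  have hbinvB : (b : K)⁻¹ ∈ B := by
    have hmem : (1 : K) * (b : K)⁻¹ ∈ locAt O B := mul_inv_mem_locAt O B B.one_mem b.2 hbinvO
    rwa [one_mul, hfix] at hmem
  exact IsUnit.of_mul_eq_one (⟨(b : K)⁻¹, hbinvB⟩ : ↥B) (Subtype.ext (mul_inv_cancel₀ hb0))

end Summit.ResolutionOfSingularities.ResolutionOfSingularities.Theorems.SyzygyFlattening

end
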